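import Summits.CriticalPhenomena.PercolationContinuityZ3.Theorems.PercNearOneGluingNoHeavyLowerTailMajorityGluingTypeTableFixedMRelaw
import HarnessLib

/-!
# The fixed-`M` programme in the kernel: the `24 → 4` order-class cover
(lane prim-rate, constants-miner 1, gen 28; KERNEL-WINDOW.md §3 item 5, §4; CONVEX-BOOTSTRAP.md §5 «4 order classes instead of 24»)

Support file for the closed crux `NoHeavyLowerTail` (stmt-CriticalPhenomena-4575), majority-gluing line; continuation of
`…TypeTableFixedMRelaw` (`SymLaw`, `SymLaw.transport`, `E_relaw`).  Every law orders its four layers somehow (`exists_chain4`,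
an insertion sort on `T_1,…,T_4`), every order is brought into one of the four classes «position of relay 1» by a permutation
of `{2,3,4}` (`sort_class`, by `decide`), a chain plus the richness pattern read off the law gives the case hypotheses
`FMLawB` (`FMLawB_of_SymLaw`; the order rows of the concrete class lists by evaluation), and the relabelled law keeps the
symmetric hypotheses and the objective.  Hence

  **`cover`: if `E ≤ V` for every law of every class case `⟨ω, r⟩`, `ω ∈ ORD4` (e.g. by 64 `checkFMB` certificates and
  `fixedMB_sound`), then `E(x) ≤ V` for EVERY law with the symmetric hypotheses `SymLaw k M x`, `0 < M ≤ 2^{−k/32}`.**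

No sorries.  [cite: VandenbergHaggstromKahn2005, Thm. 1.3 (p. 6)]
-/

namespace Summit.CriticalPhenomena.PercolationContinuityZ3.Theorems

namespace HubOnly
namespace TypeTable

open DType

noncomputable section

variable {σ : ℕ × ℕ × ℕ} (x : DType → ℝ)

/-! ### From the symmetric hypotheses to a case: order chains, richness patterns, the `24 → 4` cover -/

/-- The four order classes «position of relay 1». -/
def ORD4 : List (List ℕ) := [[1, 2, 3, 4], [2, 1, 3, 4], [2, 3, 1, 4], [2, 3, 4, 1]]

/-- The 24 orders of the relays. -/
def perms24 : List (List ℕ) :=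
  [[1, 2, 3, 4], [1, 2, 4, 3], [1, 3, 2, 4], [1, 3, 4, 2], [1, 4, 2, 3], [1, 4, 3, 2],
   [2, 1, 3, 4], [2, 1, 4, 3], [2, 3, 1, 4], [2, 3, 4, 1], [2, 4, 1, 3], [2, 4, 3, 1],
   [3, 1, 2, 4], [3, 1, 4, 2], [3, 2, 1, 4], [3, 2, 4, 1], [3, 4, 1, 2], [3, 4, 2, 1],
   [4, 1, 2, 3], [4, 1, 3, 2], [4, 2, 1, 3], [4, 2, 3, 1], [4, 3, 1, 2], [4, 3, 2, 1]]

/-- `T_a ≥ T_b ≥ T_c ≥ T_d`. -/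
def Chain4 (a b c d : ℕ) (x : DType → ℝ) : Prop := Tm b x ≤ Tm a x ∧ Tm c x ≤ Tm b x ∧ Tm d x ≤ Tm c x

/-- Every order of the four relays is brought into one of the four classes by a permutation of `{2,3,4}`, and its entries are relays. -/
theorem sort_class : ∀ ω ∈ perms24, (∀ z ∈ ω, z ∈ [1, 2, 3, 4]) ∧ ∃ σ ∈ perms3, ω.map (appP σ) ∈ ORD4 := by decide

/-- A chain transports: `Chain4 a b c d x → Chain4 (σa) (σb) (σc) (σd) (x ∘ relabel σ⁻¹)`. -/
theorem Chain4.transport (hσ : σ ∈ perms3) {a b c d : ℕ} (ha : a ∈ [1, 2, 3, 4]) (hb : b ∈ [1, 2, 3, 4])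
    (hc : c ∈ [1, 2, 3, 4]) (hd : d ∈ [1, 2, 3, 4]) (h : Chain4 a b c d x) :
    Chain4 (appP σ a) (appP σ b) (appP σ c) (appP σ d) (relaw σ x) := by
  obtain ⟨h1, h2, h3⟩ := h
  refine ⟨?_, ?_, ?_⟩
  · rw [Tm_tr hσ x a ha, Tm_tr hσ x b hb]; exact h1
  · rw [Tm_tr hσ x b hb, Tm_tr hσ x c hc]; exact h2
  · rw [Tm_tr hσ x c hc, Tm_tr hσ x d hd]; exact h3

/-- Some order of the layers always holds (a tournament on four vertices has a Hamiltonian path). -/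
theorem exists_chain4 (x : DType → ℝ) : ∃ a b c d : ℕ, [a, b, c, d] ∈ perms24 ∧ Chain4 a b c d x := by
  unfold Chain4
  rcases le_total (Tm 1 x) (Tm 2 x) with h1 | h1
  · rcases le_total (Tm 2 x) (Tm 3 x) with h2 | h2
    · rcases le_total (Tm 3 x) (Tm 4 x) with h3 | h3
      · exact ⟨4, 3, 2, 1, by decide, h3, h2, h1⟩
      · rcases le_total (Tm 2 x) (Tm 4 x) with h4 | h4
        · exact ⟨3, 4, 2, 1, by decide, h3, h4, h1⟩
        · rcases le_total (Tm 1 x) (Tm 4 x) with h5 | h5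
          · exact ⟨3, 2, 4, 1, by decide, h2, h4, h5⟩
          · exact ⟨3, 2, 1, 4, by decide, h2, h1, h5⟩
    · rcases le_total (Tm 1 x) (Tm 3 x) with h6 | h6
      · rcases le_total (Tm 2 x) (Tm 4 x) with h7 | h7
        · exact ⟨4, 2, 3, 1, by decide, h7, h2, h6⟩
        · rcases le_total (Tm 3 x) (Tm 4 x) with h8 | h8
          · exact ⟨2, 4, 3, 1, by decide, h7, h8, h6⟩
          · rcases le_total (Tm 1 x) (Tm 4 x) with h9 | h9
            · exact ⟨2, 3, 4, 1, by decide, h2, h8, h9⟩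
            · exact ⟨2, 3, 1, 4, by decide, h2, h6, h9⟩
      · rcases le_total (Tm 2 x) (Tm 4 x) with h10 | h10
        · exact ⟨4, 2, 1, 3, by decide, h10, h1, h6⟩
        · rcases le_total (Tm 1 x) (Tm 4 x) with h11 | h11
          · exact ⟨2, 4, 1, 3, by decide, h10, h11, h6⟩
          · rcases le_total (Tm 3 x) (Tm 4 x) with h12 | h12
            · exact ⟨2, 1, 4, 3, by decide, h1, h11, h12⟩
            · exact ⟨2, 1, 3, 4, by decide, h1, h6, h12⟩
  · rcases le_total (Tm 1 x) (Tm 3 x) with h13 | h13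
    · rcases le_total (Tm 3 x) (Tm 4 x) with h14 | h14
      · exact ⟨4, 3, 1, 2, by decide, h14, h13, h1⟩
      · rcases le_total (Tm 1 x) (Tm 4 x) with h15 | h15
        · exact ⟨3, 4, 1, 2, by decide, h14, h15, h1⟩
        · rcases le_total (Tm 2 x) (Tm 4 x) with h16 | h16
          · exact ⟨3, 1, 4, 2, by decide, h13, h15, h16⟩
          · exact ⟨3, 1, 2, 4, by decide, h13, h1, h16⟩
    · rcases le_total (Tm 2 x) (Tm 3 x) with h17 | h17
      · rcases le_total (Tm 1 x) (Tm 4 x) with h18 | h18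
        · exact ⟨4, 1, 3, 2, by decide, h18, h13, h17⟩
        · rcases le_total (Tm 3 x) (Tm 4 x) with h19 | h19
          · exact ⟨1, 4, 3, 2, by decide, h18, h19, h17⟩
          · rcases le_total (Tm 2 x) (Tm 4 x) with h20 | h20
            · exact ⟨1, 3, 4, 2, by decide, h13, h19, h20⟩
            · exact ⟨1, 3, 2, 4, by decide, h13, h17, h20⟩
      · rcases le_total (Tm 1 x) (Tm 4 x) with h21 | h21
        · exact ⟨4, 1, 2, 3, by decide, h21, h1, h17⟩
        · rcases le_total (Tm 2 x) (Tm 4 x) with h22 | h22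
          · exact ⟨1, 4, 2, 3, by decide, h21, h22, h17⟩
          · rcases le_total (Tm 3 x) (Tm 4 x) with h23 | h23
            · exact ⟨1, 2, 4, 3, by decide, h1, h22, h23⟩
            · exact ⟨1, 2, 3, 4, by decide, h1, h17, h23⟩

/-- The order rows of a class case from its chain. -/
theorem order_of_chain4 {a b c d : ℕ} (hω : [a, b, c, d] ∈ ORD4) {r : ℕ → Bool} (h : Chain4 a b c d x) :
    ∀ p q, FMCase.before ⟨[a, b, c, d], r⟩ p q = true → Tm q x ≤ Tm p x := by
  intro p q hpq
  have hp : p ∈ [a, b, c, d] := by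
    simp only [FMCase.before, Bool.and_eq_true, decide_eq_true_eq] at hpq; exact hpq.1.1
  have hq : q ∈ [a, b, c, d] := by
    simp only [FMCase.before, Bool.and_eq_true, decide_eq_true_eq] at hpq; exact hpq.1.2
  obtain ⟨h1, h2, h3⟩ := h
  simp only [ORD4, List.mem_cons, List.not_mem_nil, or_false, List.cons.injEq, and_true] at hω
  rcases hω with ⟨rfl, rfl, rfl, rfl⟩ | ⟨rfl, rfl, rfl, rfl⟩ | ⟨rfl, rfl, rfl, rfl⟩ | ⟨rfl, rfl, rfl, rfl⟩ <;>
  · simp only [List.mem_cons, List.not_mem_nil, or_false] at hp hq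
    rcases hp with rfl | rfl | rfl | rfl <;> rcases hq with rfl | rfl | rfl | rfl <;>
      first | exact absurd hpq Bool.false_ne_true | linarith

/-- **From the symmetric hypotheses to a class case.**  A symmetric law with the chain of a class order satisfies `FMLawB`
for the richness pattern `r` read off the law itself. -/
theorem FMLawB_of_SymLaw {k : ℕ} {M : ℝ} (L : SymLaw k M x) {a b c d : ℕ} (hω : [a, b, c, d] ∈ ORD4)
    (h : Chain4 a b c d x) (r : ℕ → Bool) (hr : ∀ z ∈ [1, 2, 3, 4], r z = true ↔ 2 * Tm z x ≤ Sm z x) :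
    FMLawB ⟨[a, b, c, d], r⟩ k M x where
  nonneg := L.nonneg
  linRows := L.linRows
  norm := L.norm
  order := order_of_chain4 x hω h
  richB := fun z hz hrz => (hr z hz).1 hrz
  poorB := fun z hz hrz => by
    have h' : ¬ (2 * Tm z x ≤ Sm z x) := fun hh => by
      have := (hr z hz).2 hh; simp only at hrz; rw [this] at hrz; exact Bool.noConfusion hrz
    linarith
  hub := fun a ha b hb hab => L.hub a ha b hb (Nat.ne_of_lt hab)
  rel := L.rel
  Mpos := L.Mpos
  Mle := L.Mle
  isoH := fun a ha b hb hab => L.isoH a ha b hb (Nat.ne_of_lt hab)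
  isoR := fun a ha b hb c hc hab hbc =>
    L.isoR a ha b hb c hc (Nat.ne_of_lt hab) (Nat.ne_of_lt (hab.trans hbc)) (Nat.ne_of_lt hbc)
  iso4 := L.iso4
  isoH4 := fun a ha b hb c hc hab hbc =>
    L.isoH4 a ha b hb c hc (Nat.ne_of_lt hab) (Nat.ne_of_lt (hab.trans hbc)) (Nat.ne_of_lt hbc)
  iso5 := L.iso5

/-- The 16 richness patterns as sublists of `[1,2,3,4]`. -/
def PAT16 : List (List ℕ) :=
  [[], [1], [2], [3], [4], [1, 2], [1, 3], [1, 4], [2, 3], [2, 4], [3, 4], [1, 2, 3], [1, 2, 4], [1, 3, 4], [2, 3, 4], [1, 2, 3, 4]]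

/-- **THE COVER.**  If every class case `⟨ω, 1[· ∈ L]⟩`, `ω ∈ ORD4`, `L ∈ PAT16`, is certified at level `V` (e.g. by 64
`checkFMB` certificates and `fixedMB_sound`), then `E(x) ≤ V` for EVERY law satisfying the symmetric hypotheses at hub
weights `0 < M ≤ 2^{−k/32}` — the 24 orders of the layers reduce to the 4 classes by relabelling the relays `2,3,4`, which
preserves the hypotheses (`SymLaw.transport`) and the objective (`E_relaw`); the richness pattern is read off the law. -/
theorem cover {k : ℕ} {V : ℝ}
    (hcert : ∀ ω ∈ ORD4, ∀ L ∈ PAT16, ∀ (M : ℝ) (x : DType → ℝ), FMLawB ⟨ω, fun z => decide (z ∈ L)⟩ k M x → E x ≤ V)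
    {M : ℝ} {x : DType → ℝ} (L : SymLaw k M x) : E x ≤ V := by
  classical
  obtain ⟨a, b, c, d, hω, hch⟩ := exists_chain4 x
  obtain ⟨hmem, σ, hσ, hcls⟩ := sort_class _ hω
  have ha := hmem a (by simp); have hb := hmem b (by simp); have hc := hmem c (by simp); have hd := hmem d (by simp)
  have hch' := Chain4.transport x hσ ha hb hc hd hch
  have L' := L.transport hσ
  set x' := relaw σ x with hx'
  -- the richness pattern of x' as one of the 16 sublists
  obtain ⟨Lr, hLr, hr⟩ : ∃ Lr ∈ PAT16, ∀ z ∈ [1, 2, 3, 4], decide (z ∈ Lr) = true ↔ 2 * Tm z x' ≤ Sm z x' := by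
    by_cases h1 : 2 * Tm 1 x' ≤ Sm 1 x' <;> by_cases h2 : 2 * Tm 2 x' ≤ Sm 2 x' <;>
    by_cases h3 : 2 * Tm 3 x' ≤ Sm 3 x' <;> by_cases h4 : 2 * Tm 4 x' ≤ Sm 4 x' <;>
    · refine ⟨[1, 2, 3, 4].filter fun z => (z = 1 ∧ 2 * Tm 1 x' ≤ Sm 1 x') ∨ (z = 2 ∧ 2 * Tm 2 x' ≤ Sm 2 x') ∨
          (z = 3 ∧ 2 * Tm 3 x' ≤ Sm 3 x') ∨ (z = 4 ∧ 2 * Tm 4 x' ≤ Sm 4 x'), ?_, ?_⟩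
      · simp [h1, h2, h3, h4, PAT16]
      · intro z hz
        simp only [List.mem_cons, List.not_mem_nil, or_false] at hz
        rcases hz with rfl | rfl | rfl | rfl <;> simp [h1, h2, h3, h4]
  have hcls' : [appP σ a, appP σ b, appP σ c, appP σ d] ∈ ORD4 := by simpa using hcls
  have hF := FMLawB_of_SymLaw x' L' hcls' hch' (fun z => decide (z ∈ Lr)) hr
  rw [← E_relaw x hσ]
  exact hcert _ hcls' Lr hLr M x' hF

end

end TypeTable
end HubOnly

end Summit.CriticalPhenomena.PercolationContinuityZ3.Theorems
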